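import Literature.NumberTheory.Weil1965.AdelicGaussTransformMajorant
import Literature.NumberTheory.Weil1965.AdelicFibreMeasuresCutoff
import Literature.Analysis.Distribution.SchwartzUniformTemperateFamily
import HarnessLib

/-!
# The adelic Gauss-transform majorant UNIFORMLY along tensor cut-off families `Φ · (θ_n ⊗ 𝟙_{U_n})`

Topic `NumberTheory/Weil1965`; namespace `Literature.NumberTheory.Weil1965`.  KERNEL mathematics only (theorems; no definition,
no named fact, no `axiom`, no `sorry`).  Sequel of ★ `AdelicGaussTransformMajorant` (Weil's majorant (B)
`‖∫ chirp(η•S) Φ dν‖ ≤ A(Φ) · h(1,η)^{−m/2}` for ONE `Φ ∈ 𝒮(𝔸_F^m)`) and of ★ `AdelicFibreMeasuresCutoff` (tensor cut-offs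
`c_n = β_n ⊗ 𝟙_{U_n}`, the dilation family `β_n = β_0((n+1)⁻¹ ·)` of its ED. 2, `eventually_mul_indicator_eq_self`).

For a totally real `F`, `S ∈ Sym_m(F)` with `det S ≠ 0`, a Haar measure `ν` on `𝔸_F^m` and TENSOR CUT-OFFS `c_n = θ_n ⊗ 𝟙_{U_n}` —
`θ_n` smooth real functions on `(F ⊗ ℝ)^m` with UNIFORMLY BOUNDED DERIVATIVES, `U_n` a compact open exhaustion of `(𝔸_F^∞)^m` — the
majorant holds for the whole family `{Φ c_n}_n` with ONE constant: `‖∫ chirp(η•S) (Φ c_n) dν‖ ≤ C · h(1,η)^{−m/2}` for all `n` and all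
adeles `η` (`exists_norm_integral_chirp_mul_cutoff_le`), GIVEN the uniform bound for tensor families `{(Φ_∞ θ_n) ⊗ Φ_f}_n` with a
fixed finite part (hypothesis `hUT`; it is the uniform form of ★ `exists_norm_integral_chirp_smul_ratMatrix_le_vecHeight` over an
archimedean family with bounded Schwartz seminorms, whose seminorm input is §1 here):

* §1 multiplier families with uniformly bounded derivatives: precomposition with linear contractions
  (`norm_iteratedFDeriv_comp_clm_le`, `exists_forall_norm_iteratedFDeriv_comp_le_uniform`), the dilated bumps of ★
  `exists_tensor_cutoff_dilate` (`exists_forall_norm_iteratedFDeriv_bump_dilate_le`), and the resulting UNIFORM Schwartz seminorm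
  bounds for `Φ_∞ · θ_n` (`exists_forall_seminorm_smulLeftCLM_le_of_bounded_derivs`, by ★
  `SchwartzUniformTemperateFamily.exists_seminorm_smulLeftCLM_le_uniform` with growth exponent `0`);
* §2 on a pure tensor `Φ = Φ_∞ ⊗ Φ_f` the products are the tensors `(Φ_∞ θ_n) ⊗ (Φ_f 𝟙_{U_n})` whose finite part is FROZEN,
  `Φ_f 𝟙_{U_n} = Φ_f` for `n ≥ n₀`; the uniform tensor bound for `n ≥ n₀` and the pointwise majorant for the finitely many `n < n₀`
  give one constant (`exists_norm_integral_chirp_tensor_mul_cutoff_le`);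
* §3 span induction over `𝒮(𝔸_F^m)` — the bound is additive and homogeneous in `Φ` for a FIXED multiplier sequence
  (`exists_norm_integral_chirp_mul_cutoff_le`).

This is the uniformity behind Weil's "convergence uniforme sur toute partie compacte de `𝒮(X)`" [Weil1965, Chap. I n° 2, Lemme 5
and Prop. 2 (B₁); Chap. IV n° 41]: the constants of the local estimates depend on `Φ` through finitely many Schwartz seminorms.
Consumer: `AdelicSiegelFunctionalCutoffContinuity` (cut-off continuity of `E_X`, `∫ Ψ dE_X = E_X(Ψ)`).

Cell `hodgecm-mathlib`, FLOOR 0, crux H413 (stmt-HodgeConjecture-24833), E-2 ∕ SW2 road (W), row «hdom» (F0P4-p06 (g3); the uniform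
archimedean files = A-p08 (g17)).  HC_CM is proved only modulo the printed citations until rung 0 closes; this file is unconditional.

## References
* [Weil1965] A. Weil, *Sur la formule de Siegel dans la théorie des groupes classiques*, Acta Math. 113 (1965): Chap. I n° 2,
  Lemme 5 (p. 10) and Prop. 2 (p. 8); Chap. IV n° 40 Thm. 1 (p. 57), n° 41 (pp. 58–59).
* [HormanderALPDO1] L. Hörmander, *The Analysis of Linear Partial Differential Operators I*, 2nd ed. (1990), §7.1.
-/

set_option autoImplicit false

noncomputable section

open MeasureTheory Filter Topology Set NumberField NumberField.InfinitePlace NumberField.mixedEmbedding IsDedekindDomain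
open scoped NNReal ENNReal Matrix Classical SchwartzMap ContDiff
open Literature.NumberTheory.Automorphic Literature.NumberTheory.Weil1964 Literature.Analysis.Distribution

namespace Literature.NumberTheory.Weil1965

/-! ## §1 Multiplier families with uniformly bounded derivatives -/

section Multipliers

variable {V : Type*} [NormedAddCommGroup V] [NormedSpace ℝ V] {G : Type*} [NormedAddCommGroup G] [NormedSpace ℝ G]

/-- **Precomposition with a linear contraction does not increase the derivatives**: for `‖L‖ ≤ 1` and smooth `θ`,
`‖D^i (θ ∘ L) y‖ ≤ ‖D^i θ (L y)‖` (chain rule, `D^i(θ ∘ L) y = D^i θ (L y) ∘ (L, …, L)`). [cite: HormanderALPDO1, §7.1] -/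
theorem norm_iteratedFDeriv_comp_clm_le {θ : V → G} (hθ : ContDiff ℝ ∞ θ) (L : V →L[ℝ] V) (hL : ‖L‖ ≤ 1)
    (i : ℕ) (y : V) : ‖iteratedFDeriv ℝ i (θ ∘ L) y‖ ≤ ‖iteratedFDeriv ℝ i θ (L y)‖ := by
  rw [L.iteratedFDeriv_comp_right hθ y (i := i) (mod_cast le_top)]
  calc ‖(iteratedFDeriv ℝ i θ (L y)).compContinuousLinearMap fun _ => L‖
      ≤ ‖iteratedFDeriv ℝ i θ (L y)‖ * ∏ _j : Fin i, ‖L‖ := ContinuousMultilinearMap.norm_compContinuousLinearMap_le _ _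
    _ ≤ ‖iteratedFDeriv ℝ i θ (L y)‖ * 1 := by
        refine mul_le_mul_of_nonneg_left ?_ (norm_nonneg _)
        exact Finset.prod_le_one (fun _ _ => norm_nonneg _) fun _ _ => hL
    _ = ‖iteratedFDeriv ℝ i θ (L y)‖ := mul_one _

/-- **A smooth compactly supported function has bounded derivatives of every order up to `N`**: one constant `C ≥ 0` with
`‖D^i θ y‖ ≤ C` for all `i ≤ N` and all `y`. [cite: HormanderALPDO1, §7.1] -/
theorem exists_forall_norm_iteratedFDeriv_le_of_hasCompactSupport {θ : V → G} (hθ : ContDiff ℝ ∞ θ)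
    (hθc : HasCompactSupport θ) (N : ℕ) : ∃ C : ℝ, 0 ≤ C ∧ ∀ i ≤ N, ∀ y, ‖iteratedFDeriv ℝ i θ y‖ ≤ C := by
  have hb : ∀ i : ℕ, ∃ C : ℝ, ∀ y, ‖iteratedFDeriv ℝ i θ y‖ ≤ C := fun i =>
    (hθ.continuous_iteratedFDeriv (mod_cast le_top)).bounded_above_of_compact_support (hθc.iteratedFDeriv i)
  choose C hC using hb
  refine ⟨∑ i ∈ Finset.range (N + 1), |C i|, Finset.sum_nonneg fun i _ => abs_nonneg _, fun i hi y => ?_⟩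
  exact ((hC i y).trans (le_abs_self _)).trans
    (Finset.single_le_sum (f := fun i => |C i|) (fun j _ => abs_nonneg _) (Finset.mem_range_succ_iff.2 hi))

/-- **DILATES of one smooth compactly supported profile have UNIFORMLY bounded derivatives**: if
`θ_n = θ₀ ∘ L_n` with linear `‖L_n‖ ≤ 1` (e.g. `L_n = (n+1)⁻¹ · id`), then for every `N` one constant bounds `‖D^i θ_n y‖`,
`i ≤ N`, for all `n` and `y`. [cite: Weil1965, Chap. I n° 2, Lemme 5, p. 10] -/
theorem exists_forall_norm_iteratedFDeriv_comp_le_uniform {θ₀ : V → G} (hθ : ContDiff ℝ ∞ θ₀)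
    (hθc : HasCompactSupport θ₀) {ι' : Type*} (L : ι' → V →L[ℝ] V) (hL : ∀ n, ‖L n‖ ≤ 1) (N : ℕ) :
    ∃ C : ℝ, 0 ≤ C ∧ ∀ n, ∀ i ≤ N, ∀ y, ‖iteratedFDeriv ℝ i (θ₀ ∘ L n) y‖ ≤ C := by
  obtain ⟨C, hC0, hC⟩ := exists_forall_norm_iteratedFDeriv_le_of_hasCompactSupport hθ hθc N
  exact ⟨C, hC0, fun n i hi y => (norm_iteratedFDeriv_comp_clm_le hθ (L n) (hL n) i y).trans (hC i hi _)⟩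

/-- complexification does not change the norms of the derivatives of a real function. [folklore] -/
private theorem norm_iteratedFDeriv_ofReal_comp {θ : V → ℝ} (hθ : ContDiff ℝ ∞ θ) (i : ℕ) (y : V) :
    ‖iteratedFDeriv ℝ i (fun y => (θ y : ℂ)) y‖ = ‖iteratedFDeriv ℝ i θ y‖ :=
  Complex.ofRealLI.norm_iteratedFDeriv_comp_left (f := θ) hθ.contDiffAt (mod_cast le_top)

/-- **Uniform Schwartz seminorm bounds for `Φ_∞ · θ_n`** over a family of smooth REAL multipliers with uniformly bounded
derivatives (★ `exists_seminorm_smulLeftCLM_le_uniform` with growth exponent `l = 0`): the hypothesis `hf` of the uniform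
archimedean Gauss-transform bounds. [cite: HormanderALPDO1, §7.1] -/
theorem exists_forall_seminorm_smulLeftCLM_le_of_bounded_derivs {E : Type*} [NormedAddCommGroup E] [NormedSpace ℝ E]
    [NormedSpace ℂ E] {ι' : Type*} {T : Set ι'} {θ : ι' → V → ℝ} (hθs : ∀ n ∈ T, ContDiff ℝ ∞ (θ n))
    (hθb : ∀ N : ℕ, ∃ C : ℝ, 0 ≤ C ∧ ∀ n ∈ T, ∀ i ≤ N, ∀ y, ‖iteratedFDeriv ℝ i (θ n) y‖ ≤ C)
    (Φ : 𝓢(V, E)) (p : ℕ × ℕ) :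
    ∃ M : ℝ, ∀ n ∈ T, SchwartzMap.seminorm ℂ p.1 p.2
      (SchwartzMap.smulLeftCLM E (fun y => (θ n y : ℂ)) Φ) ≤ M := by
  have hsmooth : ∀ n ∈ T, ContDiff ℝ ∞ (fun y => (θ n y : ℂ)) := fun n hn =>
    Complex.ofRealCLM.contDiff.comp (hθs n hn)
  have hg : ∀ N : ℕ, ∃ (l : ℕ) (C : ℝ), 0 ≤ C ∧ ∀ n ∈ T, ∀ i ≤ N, ∀ y,
      ‖iteratedFDeriv ℝ i (fun y => (θ n y : ℂ)) y‖ ≤ C * (1 + ‖y‖) ^ l := fun N => by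
    obtain ⟨C, hC0, hC⟩ := hθb N
    refine ⟨0, C, hC0, fun n hn i hi y => ?_⟩
    rw [pow_zero, mul_one, norm_iteratedFDeriv_ofReal_comp (hθs n hn)]
    exact hC n hn i hi y
  obtain ⟨s, C', -, hb⟩ := exists_seminorm_smulLeftCLM_le_uniform (𝕜 := ℂ) (E := E) hsmooth hg p.1 p.2
  exact ⟨C' * (s.sup (schwartzSeminormFamily ℂ V E)) Φ, fun n hn => hb n hn Φ⟩

end Multipliers


section Dilate

variable {V : Type*} [NormedAddCommGroup V] [NormedSpace ℝ V] [FiniteDimensional ℝ V]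

/-- **Dilated bumps have uniformly bounded derivatives**: for smooth bumps `β_n` with `β_n(y) = β_0((n+1)⁻¹ y)` and every `N`,
one constant bounds `‖D^i β_n y‖` for `i ≤ N`, all `n`, all `y` (`‖(n+1)⁻¹ · id‖ ≤ 1` and
`exists_forall_norm_iteratedFDeriv_comp_le_uniform`). [cite: Weil1965, Chap. I n° 2, Lemme 5, p. 10] -/
theorem exists_forall_norm_iteratedFDeriv_bump_dilate_le (β : ℕ → ContDiffBump (0 : V))
    (hβ : ∀ n (y : V), β n y = β 0 (((n : ℝ) + 1)⁻¹ • y)) (N : ℕ) :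
    ∃ C : ℝ, 0 ≤ C ∧ ∀ n, ∀ i ≤ N, ∀ y, ‖iteratedFDeriv ℝ i (β n) y‖ ≤ C := by
  set L : ℕ → V →L[ℝ] V := fun n => (((n : ℝ) + 1)⁻¹ : ℝ) • ContinuousLinearMap.id ℝ V with hL
  have hLn : ∀ n, ‖L n‖ ≤ 1 := fun n => by
    have hn : (0 : ℝ) ≤ ((n : ℝ) + 1)⁻¹ := by positivity
    have hn1 : ((n : ℝ) + 1)⁻¹ ≤ 1 := inv_le_one_of_one_le₀ (by linarith [(Nat.cast_nonneg n : (0 : ℝ) ≤ n)])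
    calc ‖L n‖ ≤ ‖(((n : ℝ) + 1)⁻¹ : ℝ)‖ * ‖ContinuousLinearMap.id ℝ V‖ := ContinuousLinearMap.opNorm_smul_le _ _
      _ ≤ 1 * 1 := mul_le_mul (by rw [Real.norm_of_nonneg hn]; exact hn1) ContinuousLinearMap.norm_id_le
          (norm_nonneg _) zero_le_one
      _ = 1 := mul_one _
  have hcomp : ∀ n, ((β n : V → ℝ)) = (β 0 : V → ℝ) ∘ L n := fun n => funext fun y => hβ n y
  obtain ⟨C, hC0, hC⟩ := exists_forall_norm_iteratedFDeriv_comp_le_uniform (β 0).contDiff (β 0).hasCompactSupport L hLn N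
  exact ⟨C, hC0, fun n i hi y => by rw [hcomp n]; exact hC n i hi y⟩

end Dilate


/-! ## §2 The cut-off family on a pure tensor: frozen finite part and the uniform archimedean bound -/

section Tensor

variable (F : Type) [Field F] [NumberField F] [IsTotallyReal F] {m : ℕ}
  [MeasurableSpace (AdeleRing (𝓞 F) F)] [BorelSpace (AdeleRing (𝓞 F) F)]

omit [IsTotallyReal F] [MeasurableSpace (AdeleRing (𝓞 F) F)] [BorelSpace (AdeleRing (𝓞 F) F)] in
/-- `(𝔸_F^∞)^m` is Hausdorff. [folklore] -/
private theorem t2Space_piFinAdele : T2Space (Fin m → FiniteAdeleRing (𝓞 F) F) := by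
  haveI : T2Space (FiniteAdeleRing (𝓞 F) F) := inferInstanceAs <| T2Space
    (RestrictedProduct (fun w : HeightOneSpectrum (𝓞 F) => w.adicCompletion F)
      (fun w => (w.adicCompletionIntegers F : Set (w.adicCompletion F))) Filter.cofinite)
  infer_instance

omit [IsTotallyReal F] [MeasurableSpace (AdeleRing (𝓞 F) F)] [BorelSpace (AdeleRing (𝓞 F) F)] in
/-- the real indicator coerced to `ℂ` is the complex indicator. [folklore] -/
private theorem ofReal_indicator_one {X : Type*} (U : Set X) (z : X) :
    ((U.indicator (1 : X → ℝ) z : ℝ) : ℂ) = U.indicator (1 : X → ℂ) z := by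
  by_cases hz : z ∈ U
  · simp only [Set.indicator_of_mem hz, Pi.one_apply, Complex.ofReal_one]
  · simp only [Set.indicator_of_notMem hz, Complex.ofReal_zero]

/-- a smooth real function with bounded derivatives, complexified, has temperate growth. [cite: HormanderALPDO1, §7.1] -/
theorem hasTemperateGrowth_ofReal_of_bounded_derivs {V : Type*} [NormedAddCommGroup V] [NormedSpace ℝ V]
    {θ : V → ℝ} (hθs : ContDiff ℝ ∞ θ) (hθb : ∀ i : ℕ, ∃ C : ℝ, ∀ y, ‖iteratedFDeriv ℝ i θ y‖ ≤ C) :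
    (fun y => (θ y : ℂ)).HasTemperateGrowth := by
  refine ⟨Complex.ofRealCLM.contDiff.comp hθs, fun i => ?_⟩
  obtain ⟨C, hC⟩ := hθb i
  refine ⟨0, C, fun y => ?_⟩
  rw [pow_zero, mul_one, norm_iteratedFDeriv_ofReal_comp hθs]
  exact hC y

/-- **THE CUT-OFF FAMILY ON A PURE TENSOR.** For `Φ = Φ_∞ ⊗ Φ_f`, smooth real multipliers `θ_n` with uniformly bounded
derivatives and a compact open exhaustion `U_n ↑ (𝔸_F^∞)^m`, the cut-off products `Φ · c_n`, `c_n = θ_n ⊗ 𝟙_{U_n}`, are the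
tensors `(Φ_∞ θ_n) ⊗ (Φ_f 𝟙_{U_n})`; the finite part is FROZEN, `Φ_f 𝟙_{U_n} = Φ_f` for `n ≥ n₀` (★ `eventually_mul_indicator_eq_self`),
so a bound for the tensor family `{(Φ_∞ θ_n) ⊗ Φ_f}_n` UNIFORM in `n` (hypothesis `hunif`, the uniform form of Weil's majorant (B))
and the pointwise majorant ★ `exists_norm_integral_chirp_smul_ratMatrix_le_vecHeight` for the finitely many `n < n₀` give ONE
constant: `‖∫ chirp(η•S) (Φ c_n) dν‖ ≤ C · h(1,η)^{−m/2}` for all `n` and all adeles `η`.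
[cite: Weil1965, Chap. I n° 2, Lemme 5 p. 10 and Prop. 2 p. 8; Chap. IV n° 41, p. 59] -/
theorem exists_norm_integral_chirp_tensor_mul_cutoff_le (ν : Measure (Fin m → AdeleRing (𝓞 F) F)) [ν.IsAddHaarMeasure]
    {S : Matrix (Fin m) (Fin m) F} (hS : S.IsSymm) (hdet : S.det ≠ 0)
    (Φinf : 𝓢((Fin m → mixedSpace F), ℂ)) {Φfin : (Fin m → FiniteAdeleRing (𝓞 F) F) → ℂ}
    (hfin : Φfin ∈ SchwartzBruhat (Fin m → FiniteAdeleRing (𝓞 F) F))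
    {θ : ℕ → (Fin m → mixedSpace F) → ℝ} (hθs : ∀ n, ContDiff ℝ ∞ (θ n))
    (hθb : ∀ N : ℕ, ∃ C : ℝ, 0 ≤ C ∧ ∀ n, ∀ i ≤ N, ∀ y, ‖iteratedFDeriv ℝ i (θ n) y‖ ≤ C)
    {U : ℕ → Set (Fin m → FiniteAdeleRing (𝓞 F) F)} (hUc : ∀ n, IsCompact (U n)) (hUo : ∀ n, IsOpen (U n))
    (hUmono : Monotone U) (hUcov : ∀ z, ∃ n, z ∈ U n)
    (c : ℕ → (Fin m → AdeleRing (𝓞 F) F) → ℝ)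
    (hc : ∀ n v, c n v = θ n (piArch F (Fin m) v) * (U n).indicator 1 (piFinite F (Fin m) v))
    (hunif : ∃ A : ℝ, 0 ≤ A ∧ ∀ (n : ℕ) (η : AdeleRing (𝓞 F) F),
      ‖∫ x, chirp F (η • ratMatrix F S)
          (fun v => SchwartzMap.smulLeftCLM ℂ (fun y => (θ n y : ℂ)) Φinf (piArch F (Fin m) v) *
            Φfin (piFinite F (Fin m) v)) x ∂ν‖ ≤
        A * (vecHeight F (![1, η] : Fin 2 → AdeleRing (𝓞 F) F) : ℝ) ^ (-((m : ℝ) / 2))) :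
    ∃ C : ℝ, 0 ≤ C ∧ ∀ (n : ℕ) (η : AdeleRing (𝓞 F) F),
      ‖∫ x, chirp F (η • ratMatrix F S)
          (fun v => (Φinf (piArch F (Fin m) v) * Φfin (piFinite F (Fin m) v)) * (c n v : ℂ)) x ∂ν‖ ≤
        C * (vecHeight F (![1, η] : Fin 2 → AdeleRing (𝓞 F) F) : ℝ) ^ (-((m : ℝ) / 2)) := by
  classical
  haveI : T2Space (Fin m → FiniteAdeleRing (𝓞 F) F) := t2Space_piFinAdele F
  -- the multipliers have temperate growth, so `smulLeftCLM` is pointwise multiplication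
  have htemp : ∀ n, (fun y => (θ n y : ℂ)).HasTemperateGrowth := fun n =>
    hasTemperateGrowth_ofReal_of_bounded_derivs (hθs n) fun i => by
      obtain ⟨C, -, hC⟩ := hθb i
      exact ⟨C, fun y => hC n i le_rfl y⟩
  set f : ℕ → 𝓢((Fin m → mixedSpace F), ℂ) := fun n => SchwartzMap.smulLeftCLM ℂ (fun y => (θ n y : ℂ)) Φinf
    with hf_def
  have hf_apply : ∀ n y, f n y = (θ n y : ℂ) * Φinf y := fun n y => by
    simp only [hf_def, SchwartzMap.smulLeftCLM_apply_apply (htemp n), smul_eq_mul]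
  set g : ℕ → (Fin m → FiniteAdeleRing (𝓞 F) F) → ℂ := fun n z => Φfin z * (U n).indicator 1 z with hg_def
  have hfun : ∀ n, (fun v => (Φinf (piArch F (Fin m) v) * Φfin (piFinite F (Fin m) v)) * (c n v : ℂ)) =
      fun v => f n (piArch F (Fin m) v) * g n (piFinite F (Fin m) v) := fun n => by
    funext v
    rw [hc n v, hf_apply, Complex.ofReal_mul, ofReal_indicator_one]
    simp only [hg_def]
    ring
  -- every finite part `Φ_f 𝟙_{U_n}` is Schwartz–Bruhat
  have hfin' := (mem_schwartzBruhat_iff).1 hfin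
  have hg_mem : ∀ n, g n ∈ SchwartzBruhat (Fin m → FiniteAdeleRing (𝓞 F) F) := fun n =>
    (mem_schwartzBruhat_iff).2 ⟨hfin'.1.mul (isLocallyConstant_indicator_const ⟨(hUc n).isClosed, hUo n⟩ (1 : ℂ)),
      hfin'.2.mul_right⟩
  -- pointwise majorants for every `n`, the uniform one for `n ≥ n₀`
  have hAn : ∀ n, ∃ A : ℝ, 0 ≤ A ∧ ∀ η : AdeleRing (𝓞 F) F,
      ‖∫ x, chirp F (η • ratMatrix F S) (fun v => f n (piArch F (Fin m) v) * g n (piFinite F (Fin m) v)) x ∂ν‖ ≤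
        A * (vecHeight F (![1, η] : Fin 2 → AdeleRing (𝓞 F) F) : ℝ) ^ (-((m : ℝ) / 2)) := fun n =>
    exists_norm_integral_chirp_smul_ratMatrix_le_vecHeight F ν hS hdet (tensor_mem_piSchwartzBruhat (f n) (hg_mem n))
  choose An hAn0 hAnb using hAn
  obtain ⟨A, hA0, hA⟩ := hunif
  obtain ⟨n₀, hn₀⟩ := eventually_atTop.1 (eventually_mul_indicator_eq_self F (Fin m) hUo hUmono hUcov Φfin hfin'.2)
  refine ⟨A + ∑ k ∈ Finset.range n₀, An k, add_nonneg hA0 (Finset.sum_nonneg fun k _ => hAn0 k), fun n η => ?_⟩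
  have hH0 : 0 ≤ (vecHeight F (![1, η] : Fin 2 → AdeleRing (𝓞 F) F) : ℝ) ^ (-((m : ℝ) / 2)) :=
    Real.rpow_nonneg (NNReal.coe_nonneg _) _
  rw [hfun n]
  rcases lt_or_ge n n₀ with hn | hn
  · refine (hAnb n η).trans (mul_le_mul_of_nonneg_right ?_ hH0)
    exact le_add_of_nonneg_of_le hA0 (Finset.single_le_sum (fun k _ => hAn0 k) (Finset.mem_range.2 hn))
  · have hgn : g n = Φfin := hn₀ n hn
    rw [hgn]
    refine (hA n η).trans (mul_le_mul_of_nonneg_right ?_ hH0)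
    exact le_add_of_nonneg_right (Finset.sum_nonneg fun k _ => hAn0 k)

end Tensor

/-! ## §3 Every `Φ ∈ 𝒮(𝔸_F^m)`: span induction -/

section Span

variable (F : Type) [Field F] [NumberField F] [IsTotallyReal F] {m : ℕ}
  [MeasurableSpace (AdeleRing (𝓞 F) F)] [BorelSpace (AdeleRing (𝓞 F) F)]

omit [IsTotallyReal F] [MeasurableSpace (AdeleRing (𝓞 F) F)] [BorelSpace (AdeleRing (𝓞 F) F)] in
/-- the cut-offs `c_n = θ_n ⊗ 𝟙_{U_n}` are continuous and bounded by the `0`-th derivative bound of `θ_n`. [folklore] -/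
private theorem continuous_cutoff_and_norm_le {θ : ℕ → (Fin m → mixedSpace F) → ℝ} (hθs : ∀ n, ContDiff ℝ ∞ (θ n))
    {C₀ : ℝ} (hθ0 : ∀ n y, ‖iteratedFDeriv ℝ 0 (θ n) y‖ ≤ C₀)
    {U : ℕ → Set (Fin m → FiniteAdeleRing (𝓞 F) F)} (hUc : ∀ n, IsCompact (U n)) (hUo : ∀ n, IsOpen (U n))
    (c : ℕ → (Fin m → AdeleRing (𝓞 F) F) → ℝ)
    (hc : ∀ n v, c n v = θ n (piArch F (Fin m) v) * (U n).indicator 1 (piFinite F (Fin m) v)) (n : ℕ) :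
    Continuous (fun v => (c n v : ℂ)) ∧ ∀ v, ‖(c n v : ℂ)‖ ≤ C₀ := by
  haveI : T2Space (Fin m → FiniteAdeleRing (𝓞 F) F) := t2Space_piFinAdele F
  have hceq : (fun v => (c n v : ℂ)) = fun v => ((θ n (piArch F (Fin m) v) * (U n).indicator 1 (piFinite F (Fin m) v) : ℝ) : ℂ) :=
    funext fun v => by rw [hc n v]
  refine ⟨?_, fun v => ?_⟩
  · rw [hceq]
    refine Complex.continuous_ofReal.comp (((hθs n).continuous.comp continuous_piArch).mul ?_)
    exact (isLocallyConstant_indicator_const ⟨(hUc n).isClosed, hUo n⟩ (1 : ℝ)).continuous.comp continuous_piFinite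
  · rw [hc n v, Complex.norm_real, norm_mul]
    have h1 : ‖(U n).indicator (1 : (Fin m → FiniteAdeleRing (𝓞 F) F) → ℝ) (piFinite F (Fin m) v)‖ ≤ 1 := by
      by_cases h : piFinite F (Fin m) v ∈ U n
      · rw [Set.indicator_of_mem h, Pi.one_apply, norm_one]
      · rw [Set.indicator_of_notMem h, norm_zero]; exact zero_le_one
    have h0 : ‖θ n (piArch F (Fin m) v)‖ ≤ C₀ := by
      have := hθ0 n (piArch F (Fin m) v)
      rwa [norm_iteratedFDeriv_zero] at this
    calc ‖θ n (piArch F (Fin m) v)‖ * ‖(U n).indicator (1 : (Fin m → FiniteAdeleRing (𝓞 F) F) → ℝ) (piFinite F (Fin m) v)‖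
        ≤ C₀ * 1 := mul_le_mul h0 h1 (norm_nonneg _) ((norm_nonneg _).trans h0)
      _ = C₀ := mul_one _

/-- **THE UNIFORM MAJORANT (B) ALONG THE CUT-OFF FAMILY, every `Φ ∈ 𝒮(𝔸_F^m)`**: pure tensors span `𝒮` and the bound of
`exists_norm_integral_chirp_tensor_mul_cutoff_le` is additive and homogeneous in `Φ` for a FIXED multiplier sequence; the uniform
tensor bound enters as the hypothesis `hUT` (discharged by the uniform archimedean Gauss-transform majorant).
[cite: Weil1965, Chap. I n° 2, Lemme 5 p. 10 and Prop. 2 p. 8; Chap. IV n° 41, p. 59] -/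
theorem exists_norm_integral_chirp_mul_cutoff_le (ν : Measure (Fin m → AdeleRing (𝓞 F) F)) [ν.IsAddHaarMeasure]
    {S : Matrix (Fin m) (Fin m) F} (hS : S.IsSymm) (hdet : S.det ≠ 0)
    {θ : ℕ → (Fin m → mixedSpace F) → ℝ} (hθs : ∀ n, ContDiff ℝ ∞ (θ n))
    (hθb : ∀ N : ℕ, ∃ C : ℝ, 0 ≤ C ∧ ∀ n, ∀ i ≤ N, ∀ y, ‖iteratedFDeriv ℝ i (θ n) y‖ ≤ C)
    {U : ℕ → Set (Fin m → FiniteAdeleRing (𝓞 F) F)} (hUc : ∀ n, IsCompact (U n)) (hUo : ∀ n, IsOpen (U n))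
    (hUmono : Monotone U) (hUcov : ∀ z, ∃ n, z ∈ U n)
    (c : ℕ → (Fin m → AdeleRing (𝓞 F) F) → ℝ)
    (hc : ∀ n v, c n v = θ n (piArch F (Fin m) v) * (U n).indicator 1 (piFinite F (Fin m) v))
    (hUT : ∀ (Φinf : 𝓢((Fin m → mixedSpace F), ℂ)) {Φfin : (Fin m → FiniteAdeleRing (𝓞 F) F) → ℂ},
      Φfin ∈ SchwartzBruhat (Fin m → FiniteAdeleRing (𝓞 F) F) →
      ∃ A : ℝ, 0 ≤ A ∧ ∀ (n : ℕ) (η : AdeleRing (𝓞 F) F),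
        ‖∫ x, chirp F (η • ratMatrix F S)
            (fun v => SchwartzMap.smulLeftCLM ℂ (fun y => (θ n y : ℂ)) Φinf (piArch F (Fin m) v) *
              Φfin (piFinite F (Fin m) v)) x ∂ν‖ ≤
          A * (vecHeight F (![1, η] : Fin 2 → AdeleRing (𝓞 F) F) : ℝ) ^ (-((m : ℝ) / 2)))
    {Φ : (Fin m → AdeleRing (𝓞 F) F) → ℂ} (hΦ : Φ ∈ piSchwartzBruhat F (Fin m)) :
    ∃ C : ℝ, 0 ≤ C ∧ ∀ (n : ℕ) (η : AdeleRing (𝓞 F) F),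
      ‖∫ x, chirp F (η • ratMatrix F S) (fun v => Φ v * (c n v : ℂ)) x ∂ν‖ ≤
        C * (vecHeight F (![1, η] : Fin 2 → AdeleRing (𝓞 F) F) : ℝ) ^ (-((m : ℝ) / 2)) := by
  haveI := secondCountableTopology_adeleRing (K := F)
  haveI : BorelSpace (Fin m → AdeleRing (𝓞 F) F) := Pi.borelSpace
  obtain ⟨C₀, -, hC₀⟩ := hθb 0
  have hcont := fun n => continuous_cutoff_and_norm_le F hθs (fun n y => hC₀ n 0 le_rfl y) hUc hUo c hc n
  -- integrability of `chirp(η•S) (Ψ c_n)` for `Ψ ∈ 𝒮`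
  have hint : ∀ {Ψ : (Fin m → AdeleRing (𝓞 F) F) → ℂ}, Ψ ∈ piSchwartzBruhat F (Fin m) → ∀ (n : ℕ) (η : AdeleRing (𝓞 F) F),
      Integrable (chirp F (η • ratMatrix F S) (fun v => Ψ v * (c n v : ℂ))) ν := by
    intro Ψ hΨ n η
    have h1 : Integrable (chirp F (η • ratMatrix F S) Ψ) ν := integrable_of_mem_piSchwartzBruhat (chirp_mem hΨ _)
    have h2 := h1.mul_bdd (hcont n).1.aestronglyMeasurable (ae_of_all _ (hcont n).2)
    refine h2.congr (ae_of_all _ fun x => ?_)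
    simp only [chirp_apply, mul_assoc]
  induction hΦ using Submodule.span_induction with
  | mem Ψ hΨ =>
    obtain ⟨Φinf, Φfin, hfin, rfl⟩ := hΨ
    exact exists_norm_integral_chirp_tensor_mul_cutoff_le F ν hS hdet Φinf hfin hθs hθb hUc hUo hUmono hUcov c hc
      (hUT Φinf hfin)
  | zero =>
    refine ⟨0, le_rfl, fun n η => ?_⟩
    simp only [Pi.zero_apply, zero_mul]
    rw [show (fun _ : Fin m → AdeleRing (𝓞 F) F => (0 : ℂ)) = 0 from rfl, chirp_zero]
    simp only [Pi.zero_apply, integral_zero, norm_zero, le_refl]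
  | add Ψ₁ Ψ₂ hΨ₁ hΨ₂ h₁ h₂ =>
    obtain ⟨C₁, hC₁0, hC₁⟩ := h₁
    obtain ⟨C₂, hC₂0, hC₂⟩ := h₂
    refine ⟨C₁ + C₂, add_nonneg hC₁0 hC₂0, fun n η => ?_⟩
    have hsplit : (fun v => (Ψ₁ + Ψ₂) v * (c n v : ℂ)) = (fun v => Ψ₁ v * (c n v : ℂ)) + fun v => Ψ₂ v * (c n v : ℂ) := by
      funext v
      simp only [Pi.add_apply, add_mul]
    rw [hsplit, chirp_add]
    simp only [Pi.add_apply]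
    rw [integral_add (hint hΨ₁ n η) (hint hΨ₂ n η), add_mul]
    exact (norm_add_le _ _).trans (add_le_add (hC₁ n η) (hC₂ n η))
  | smul a Ψ hΨ h =>
    obtain ⟨C, hC0, hC⟩ := h
    refine ⟨‖a‖ * C, mul_nonneg (norm_nonneg _) hC0, fun n η => ?_⟩
    have hsplit : (fun v => (a • Ψ) v * (c n v : ℂ)) = a • fun v => Ψ v * (c n v : ℂ) := by
      funext v
      simp only [Pi.smul_apply, smul_eq_mul, mul_assoc]
    rw [hsplit, chirp_smul]
    simp only [Pi.smul_apply, smul_eq_mul]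
    rw [integral_const_mul, norm_mul, mul_assoc]
    exact mul_le_mul_of_nonneg_left (hC n η) (norm_nonneg _)

end Span

end Literature.NumberTheory.Weil1965

end
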